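import Summits.QuantumFields.YangMills.Theorems.BalabanUVNodesN07FaceDatumGeometry
import Summits.QuantumFields.YangMills.Theorems.BalabanUVNodesN07SmallActionBoundaryAvoidance
import Summits.QuantumFields.YangMills.Theorems.BalabanUVNodesK0VariationalThm1OuterRange
import Literature.MathematicalPhysics.QuantumFieldTheory.Balaban1983to89.Node00.Record12BgRowTopClass

/-!
# K0⁗ ROW P11 — FILE 21A: AN OPEN-CLASS (2.12) MINIMISER OVER THE FINAL CLASS (6) = (1.7) ∧ (1.9) (node00-def-P11 12b `VariationalThm1RegSepTop7`'s class, EVERY top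
# domain `Sup`) EXISTS FOR A SMALL-ACTION FIBRE ELEMENT — dag-n07-e 19a's boundary avoidance extended to print's co-divergence clause (1.9)

Cell `pub-ymgap`, seat `pub-ymgap-dag-n21-c` g8 (R134 (a) N21 NE7c s1; K0⁗ ROW P11 negative side of record; INBOX INTENT-1 of 2026-08-27 ≈10:00Z).  Filed
`--kind proof --supports stmt-QuantumFields-20289 --as helper`.  Part A of FILE 21 (part B = `…K0VariationalThm1Top7Floor`: the floor `2L² ≤ B₃` for `…Top7` ∕ `…Co7`).
[15] = [Balaban1985Variational]; [6] = [Balaban1985RegularSpaces]; [III] = [Balaban1988Convergent].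

WHY.  node00-def-P11's FINAL editions of the [15]-Theorem-1 named fact (FILE 11 `VariationalThm1RegSepCo7` = C′, 12b `VariationalThm1RegSepTop7 F N Sup B₃ a₀ a₁`, 12c
`…CoP7 := Top7 at suppDomOfRecord`) let the minimiser range over print's class (6) = [6] (1.7) ∧ (1.9): plaquettes `< ε₀η_n²` AND co-divergence `‖η·D^{η*}_U ∂U(b)‖ < ε₀η_n³`
(`Sect2.CoDivClassOnTop`).  Every certificate about such a fact needs a minimiser IN THAT OPEN CLASS.  dag-n07-e 19a (`exists_isMinimizer_holes_of_smallAction`) produces an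
open-class minimiser for the (1.7)-class from a fibre element of small action; here the same boundary avoidance is run through (1.9): a minimiser `U₀` over the (1.7)-class
has `A(U₀) ≤ A(U₁)` (minimality against the fibre element `U₁`), so `2N·A(U₁) < r²` bounds EVERY plaquette of `U₀` by `r` ([6] (1.10)), hence every co-divergence by `2d·r`
(dag-n07-e A1 `norm_coDivSum_le`: one term of [6] (1.2) is a difference of two conjugated plaquette variables); with `2d·r < ε₀η_k³` the minimiser lies in the Top class for
EVERY `Sup`; and it minimises there because every Top-class competitor on the same fibre lies in the (1.7)-class (COMPETITOR INCLUSION: its pinned plaquettes are the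
datum's = `U₁`'s, the others meet `Ω₁` and are bounded by the Top class's own scale-1 clause).

CONTENTS (theorems only; torus `F.P K`, `SU(N)`).
* §1 `eta_pow_three_le_of_le`, `eta_pow_three_le_sq`; ★ `coDivSmallOn_of_forall_dist1_le` ((1.7) everywhere at `m` ⇒ (1.9) at any `δ > 2d·m` on any bond set),
  ★ `mem_classTop_of_forall_dist1_lt` (plaquettes `< r` everywhere, `2d·r < ε₀η_k³` ⇒ membership in 12b's Top class at every `Sup`).
* §2 ★ `mem_class17_of_mem_classTop_of_agreeOn` (COMPETITOR INCLUSION, `k ≥ 1`).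
* §3 ★★ `exists_isMinimizer_top_of_smallAction` (the open-class minimiser over (1.7) ∧ (1.9) at every `Sup`, with its global plaquette bound `r`).

HONEST FRAMING: kernel bookkeeping about the TREE's objects (volume-dependent small-action existence, NOT Bałaban's uniform Theorem 1); nothing of Bałaban asserted or refuted;
K0⁗ neither discharged nor refuted; N21 NOT discharged; counts unmoved; no `def`, no `sorry`, no `instance`.
DEPENDENCES (by name): dag-n07-e 19a `N07SmallActionBoundaryAvoidance.(exists_isMinimizer_holes_of_smallAction, dist1_plaqHol_lt_of_wilsonAction4_lt, cornerPlaq_bonds_mem_bondsOf)`,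
A1 `N07FaceDatumAverage.norm_coDivSum_le`; p510186 `K0VariationalThm1OuterRange.plaqHol_eq_of_agreeOn_of_bonds`; node00-def-P11 12a∕12b `Sect2.(omegaPlaqsTop, omegaBondsTop,
CoDivClassOnTop)`, FILE 9 `Sect2.CoDivSmallOn`; def-R `omegaPlaqs`; r11 `IsMinimizer`, `AgreeOn`, `avgFamily`, `genSet`.
-/

noncomputable section

open scoped Matrix.Norms.L2Operator

namespace Summit.QuantumFields.YangMills.Theorems.K0TopClassSmallActionMinimiser

open Literature.MathematicalPhysics.QuantumFieldTheory.Balaban1983to89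
open Literature.MathematicalPhysics.QuantumFieldTheory.Balaban1983to89.Node00
open Literature.MathematicalPhysics.QuantumFieldTheory.Balaban1983to89.T4Continuum
open B15DeterminingSets
open Summit.QuantumFields.YangMills.BalabanUVNodes.N07FaceDatumAverage (norm_coDivSum_le)
open Summit.QuantumFields.YangMills.BalabanUVNodes.N07SmallActionBoundaryAvoidance (exists_isMinimizer_holes_of_smallAction
  dist1_plaqHol_lt_of_wilsonAction4_lt cornerPlaq_bonds_mem_bondsOf eta_sq_le_eta_sq_of_le)
open Summit.QuantumFields.YangMills.Theorems.K0VariationalThm1OuterRange (plaqHol_eq_of_agreeOn_of_bonds)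

/-! ## §1  (1.7) everywhere ⇒ (1.9) everywhere; membership in the Top class from a global plaquette bound -/
section Membership

variable {P : Params} {N : ℕ} [NeZero N]

/-- `η_k³ ≤ η_n³` for `n ≤ k` (`η_j = L^{−j}`, `L ≥ 1`). [cite: Balaban1985RegularSpaces, (1.9) p.77 (bookkeeping)] -/
theorem eta_pow_three_le_of_le {n k : ℕ} (hnk : n ≤ k) : P.eta k ^ 3 ≤ P.eta n ^ 3 := by
  have hL1 : (1 : ℝ) ≤ P.L := by exact_mod_cast P.L_pos
  have h0 : (0 : ℝ) ≤ (P.L : ℝ)⁻¹ := inv_nonneg.mpr (by positivity)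
  have h1 : (P.L : ℝ)⁻¹ ≤ 1 := inv_le_one_of_one_le₀ hL1
  unfold Params.eta
  exact pow_le_pow_left₀ (pow_nonneg h0 _) (pow_le_pow_of_le_one h0 h1 hnk) 3

/-- `η_k³ ≤ η_k²`. [cite: Balaban1985RegularSpaces, (1.7)–(1.9) p.77 (bookkeeping)] -/
theorem eta_pow_three_le_sq (k : ℕ) : P.eta k ^ 3 ≤ P.eta k ^ 2 := by
  have hL1 : (1 : ℝ) ≤ P.L := by exact_mod_cast P.L_pos
  have h0 : (0 : ℝ) ≤ (P.L : ℝ)⁻¹ := inv_nonneg.mpr (by positivity)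
  have h1 : (P.L : ℝ)⁻¹ ≤ 1 := inv_le_one_of_one_le₀ hL1
  unfold Params.eta
  exact pow_le_pow_of_le_one (pow_nonneg h0 _) (pow_le_one₀ h0 h1) (by norm_num)

/-- **★ (1.7) EVERYWHERE ⇒ (1.9) EVERYWHERE**: if every plaquette of `U` is within `m` of `1` then print's co-divergence `η·(D^{η*}_U∂U)(b)` ([6] (1.2), node00-def-P11 FILE 9
`Sect2.coDivSum`) has norm `≤ 2d·m` at every bond (dag-n07-e A1 `norm_coDivSum_le`), so (1.9) holds at every threshold `δ > 2d·m` on every bond set. [cite: Balaban1985RegularSpaces, (1.2) p.76, (1.9)–(1.10) p.77] -/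
theorem coDivSmallOn_of_forall_dist1_le {j : ℕ} (U : GaugeField P j (SU N)) {m δ : ℝ} (hm0 : 0 ≤ m)
    (hm : ∀ q, dist1 (GaugeField.plaqHol U q) ≤ m) (hδ : (P.d : ℝ) * (2 * m) < δ) (S : Set (PBond P j)) :
    Sect2.CoDivSmallOn S δ U := fun b _ => (norm_coDivSum_le U hm0 hm b.src b.dir).trans_lt hδ

/-- **★ MEMBERSHIP IN 12b's TOP CLASS FROM A GLOBAL PLAQUETTE BOUND**: plaquettes `< r` everywhere with `2d·r < ε₀η_k³` (hence `r < ε₀η_n²`, `2d·r < ε₀η_n³` for all `n ≤ k`)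
put `U` in `{(∀ n ≤ k, |U(∂p) − 1| < ε₀η_n² on omegaPlaqsTop Ω Sup n) ∧ Sect2.CoDivClassOnTop Ω Sup k ε₀ U}` for EVERY sequence `Ω` and EVERY top domain `Sup`.
[cite: Balaban1985RegularSpaces, (1.7)–(1.10) p.77; Balaban1985Variational, (2),(6) p.278] -/
theorem mem_classTop_of_forall_dist1_lt (hd : 1 ≤ P.d) (Ω : ℕ → Set (Site P 0)) (Sup : Set (Site P 0)) (k : ℕ) {ε₀ r : ℝ} (hr0 : 0 ≤ r)
    (hr : (P.d : ℝ) * (2 * r) < ε₀ * P.eta k ^ 3) {U : GaugeField P 0 (SU N)} (hU : ∀ q, dist1 (GaugeField.plaqHol U q) < r) :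
    U ∈ {U : GaugeField P 0 (SU N) | (∀ n, n ≤ k → PlaqSmallOn (Sect2.omegaPlaqsTop Ω Sup n) (ε₀ * P.eta n ^ 2) U) ∧ Sect2.CoDivClassOnTop Ω Sup k ε₀ U} := by
  have hd' : (1 : ℝ) ≤ P.d := by exact_mod_cast hd
  have hη3 : 0 ≤ P.eta k ^ 3 := pow_nonneg (pow_nonneg (inv_nonneg.mpr (Nat.cast_nonneg _)) _) 3
  -- `ε₀ > 0` unless `r = 0`-trivialities: from `hr`, `0 ≤ d·2r < ε₀η_k³`
  have hε : 0 < ε₀ * P.eta k ^ 3 := lt_of_le_of_lt (by positivity) hr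
  have hε₀ : 0 < ε₀ := by
    rcases lt_or_ge 0 ε₀ with h | h
    · exact h
    · exact absurd hε (not_lt.mpr (mul_nonpos_of_nonpos_of_nonneg h hη3))
  have hrε : r < ε₀ * P.eta k ^ 3 := by
    have : r ≤ (P.d : ℝ) * (2 * r) := by nlinarith
    exact this.trans_lt hr
  refine ⟨fun n hn q _ => (hU q).trans_le ?_, fun n hn => ?_⟩
  · calc r ≤ ε₀ * P.eta k ^ 3 := hrε.le
      _ ≤ ε₀ * P.eta n ^ 3 := mul_le_mul_of_nonneg_left (eta_pow_three_le_of_le hn) hε₀.le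
      _ ≤ ε₀ * P.eta n ^ 2 := mul_le_mul_of_nonneg_left (eta_pow_three_le_sq n) hε₀.le
  · exact coDivSmallOn_of_forall_dist1_le U hr0 (fun q => (hU q).le)
      (hr.trans_le (mul_le_mul_of_nonneg_left (eta_pow_three_le_of_le hn) hε₀.le)) _

end Membership

/-! ## §2  COMPETITOR INCLUSION: a Top-class fibre element over a globally regular datum lies in the (1.7)-class -/
section Competitors

variable {P : Params} {N : ℕ} [NeZero N]

/-- **★ COMPETITOR INCLUSION** (`k ≥ 1`).  Let `U₁` satisfy the GLOBAL (1.7)-class clauses `|U₁(∂q) − 1| < ε₀η_n²` on `omegaPlaqs Ω n`, `n ≤ k` (`omegaPlaqs Ω 0 = T`), and let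
`W` agree with `M_𝐁(U₁)` on the determining set.  Then every `V` in 12b's Top class (ANY `Sup`) that agrees with `W` on the determining set lies in the global (1.7)-class:
at scales `n ≥ 1` the clauses coincide (`omegaPlaqsTop Ω Sup n = omegaPlaqs Ω n`); at scale `0` a plaquette either meets `Ω₁` — then the Top class's scale-1 clause bounds
it by `ε₀η₁² ≤ ε₀` — or has three corners off `Ω₁`, so its four bonds are pinned (19a `cornerPlaq_bonds_mem_bondsOf`) and `V(∂q) = W₀(∂q) = U₁(∂q)` (p510186
`plaqHol_eq_of_agreeOn_of_bonds`). [cite: Balaban1985Variational, (2),(6) p.278; Balaban1988Convergent, (2.10)–(2.12) p.256] -/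
theorem mem_class17_of_mem_classTop_of_agreeOn (av : ∀ j, Averaging P j (SU N)) {Ω : ℕ → Set (Site P 0)} {Sup : Set (Site P 0)} {k : ℕ}
    (hk : 0 < k) {ε₀ : ℝ} {W : MSField P (SU N)} {U₁ V : GaugeField P 0 (SU N)}
    (hU₁ : ∀ n, n ≤ k → PlaqSmallOn (omegaPlaqs Ω n) (ε₀ * P.eta n ^ 2) U₁) (hA : AgreeOn (genSet Ω k) (avgFamily av U₁) W)
    (hV : V ∈ {U : GaugeField P 0 (SU N) | (∀ n, n ≤ k → PlaqSmallOn (Sect2.omegaPlaqsTop Ω Sup n) (ε₀ * P.eta n ^ 2) U) ∧ Sect2.CoDivClassOnTop Ω Sup k ε₀ U})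
    (hVA : AgreeOn (genSet Ω k) (avgFamily av V) W) :
    V ∈ {U : GaugeField P 0 (SU N) | ∀ n, n ≤ k → PlaqSmallOn (omegaPlaqs Ω n) (ε₀ * P.eta n ^ 2) U} := by
  intro n hn q hq
  by_cases hn0 : n = 0
  · subst hn0
    have hk1 : 1 ≤ k := hk
    by_cases hq1 : q ∈ B8Eq17ClassAkV1.plaqsOf (Ω 1)
    · -- the Top class's scale-1 clause, weakened from `ε₀η₁²` to `ε₀η₀² = ε₀`
      have h1 := hV.1 1 hk1 q (by rw [Sect2.omegaPlaqsTop_of_ne_zero Ω Sup one_ne_zero, omegaPlaqs_of_ne_zero Ω one_ne_zero]; exact hq1)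
      have hε₀ : 0 ≤ ε₀ := by
        by_contra hneg
        rw [not_le] at hneg
        exact absurd (h1.trans_le (mul_nonpos_of_nonpos_of_nonneg hneg.le (sq_nonneg _))) (not_lt.mpr (GaugeGroup.dist1_nonneg _))
      refine h1.trans_le (mul_le_mul_of_nonneg_left ?_ hε₀)
      exact eta_sq_le_eta_sq_of_le (Nat.zero_le 1)
    · -- three corners off `Ω₁`: the plaquette is pinned to `W₀ = U₁`
      have h1 : q.src ∉ Ω 1 := fun h => hq1 (Or.inl h)
      have h2 : q.src.shift q.μ ∉ Ω 1 := fun h => hq1 (Or.inr (Or.inl h))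
      have h3 : q.src.shift q.ν ∉ Ω 1 := fun h => hq1 (Or.inr (Or.inr (Or.inl h)))
      obtain ⟨hb1, hb2, hb3, hb4⟩ := cornerPlaq_bonds_mem_bondsOf hk Ω q h1 h2 h3
      have hVq : GaugeField.plaqHol V q = GaugeField.plaqHol (W 0) q := plaqHol_eq_of_agreeOn_of_bonds av hVA q hb1 hb2 hb3 hb4
      have hUq : GaugeField.plaqHol U₁ q = GaugeField.plaqHol (W 0) q := plaqHol_eq_of_agreeOn_of_bonds av hA q hb1 hb2 hb3 hb4
      rw [hVq, ← hUq]
      exact hU₁ 0 (Nat.zero_le _) q hq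
  · rw [← Sect2.omegaPlaqsTop_of_ne_zero Ω Sup hn0] at hq
    exact hV.1 n hn q hq

end Competitors

/-! ## §3  ★★ The open-class minimiser over (1.7) ∧ (1.9) at every top domain -/
section Existence

variable (F : T4Family) {N : ℕ} [NeZero N]

/-- **★★ SMALL-ACTION BOUNDARY AVOIDANCE FOR THE FINAL CLASS (6) = (1.7) ∧ (1.9), EVERY TOP DOMAIN.**  On `F.P K`, `1 ≤ k`, sequence `Ω`, top domain `Sup`, `0 ≤ ε₀ < α₀η_k²` with
`α₀` (53)-admissible (19a's letters), a radius `r ≥ 0` with `2d·r < ε₀η_k³`, and a fibre element `U₁` of the GLOBAL (1.7)-class over the datum `W` with `2N·A(U₁) < r²`: there is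
`U₀` MINIMISING (2.12) OVER 12b's Top class `{(∀ n ≤ k, |U(∂p) − 1| < ε₀η_n² on omegaPlaqsTop Ω Sup n) ∧ Sect2.CoDivClassOnTop Ω Sup k ε₀ U}` on the fibre of `W`, with every
plaquette of `U₀` within `r`.  Proof: 19a gives a minimiser `U₀` over the (1.7)-class; minimality against `U₁` gives `A(U₀) ≤ A(U₁)`, so `|U₀(∂q) − 1| < r` everywhere ([6] (1.10)),
so `U₀` is in the Top class (§1); every Top-class competitor on the fibre is in the (1.7)-class (§2), so `U₀` beats it.  Volume-dependent (through `2N·A(U₁) < r²`), NOT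
Bałaban's uniform Theorem 1. [cite: Balaban1985Variational, (2),(6) p.278, Thm 1 (8) p.279; Balaban1985RegularSpaces, (1.7)–(1.10) p.77; Balaban1988Convergent, (2.12) p.256] -/
theorem exists_isMinimizer_top_of_smallAction (K : ℕ) {k : ℕ} (hk : 0 < k) (Ω : ℕ → Set (Site (F.P K) 0)) (Sup : Set (Site (F.P K) 0)) {α₀ ε₀ r : ℝ}
    (hα : 0 < α₀) (hα3 : (143 * (((((F.P K).d + 4 : ℕ) : ℝ)) ^ 2 / 4) ^ 2) * α₀ ≤ 1 / 3)
    (hα2 : 2 * α₀ ≤ 2 * ExpMeanLog.deltaSU (Fin N) / ((((F.P K).d + 4) * (F.P K).L : ℕ) : ℝ) ^ 2)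
    (hε0 : 0 ≤ ε₀) (hε : ε₀ < α₀ * (F.P K).eta k ^ 2) (hr0 : 0 ≤ r) (hr : ((F.P K).d : ℝ) * (2 * r) < ε₀ * (F.P K).eta k ^ 3)
    {W : MSField (F.P K) (SU N)} {U₁ : GaugeField (F.P K) 0 (SU N)}
    (hU₁ : ∀ n, n ≤ k → PlaqSmallOn (omegaPlaqs Ω n) (ε₀ * (F.P K).eta n ^ 2) U₁)
    (hA : AgreeOn (genSet Ω k) (avgFamily (avOfRecord F N K) U₁) W)
    (hact : 2 * N * wilsonAction4 U₁ < r ^ 2) :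
    ∃ U₀ : GaugeField (F.P K) 0 (SU N),
      IsMinimizer (avOfRecord F N K)
          {U | (∀ n, n ≤ k → PlaqSmallOn (Sect2.omegaPlaqsTop Ω Sup n) (ε₀ * (F.P K).eta n ^ 2) U) ∧ Sect2.CoDivClassOnTop Ω Sup k ε₀ U}
          (genSet Ω k) W U₀ ∧
        ∀ q, dist1 (GaugeField.plaqHol U₀ q) < r := by
  have hd : 1 ≤ (F.P K).d := by rw [T4Family.P_d]; norm_num
  have hd' : (1 : ℝ) ≤ (F.P K).d := by exact_mod_cast hd
  have hη3 : 0 ≤ (F.P K).eta k ^ 3 := pow_nonneg (pow_nonneg (inv_nonneg.mpr (Nat.cast_nonneg _)) _) 3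
  -- `r < ε₀η_k²`, so 19a's action hypothesis holds
  have hrε : r < ε₀ * (F.P K).eta k ^ 2 := by
    have h1 : r ≤ ((F.P K).d : ℝ) * (2 * r) := by nlinarith
    exact (h1.trans_lt hr).trans_le (mul_le_mul_of_nonneg_left (eta_pow_three_le_sq k) hε0)
  have hact' : 2 * N * wilsonAction4 U₁ < (ε₀ * (F.P K).eta k ^ 2) ^ 2 :=
    hact.trans_le (pow_le_pow_left₀ hr0 hrε.le 2)
  obtain ⟨U₀, hmin⟩ := exists_isMinimizer_holes_of_smallAction F K k Ω hα hα3 hα2 hε0 hε hU₁ hA hact'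
  -- boundary avoidance through (1.9): `A(U₀) ≤ A(U₁)`
  have hAct : wilsonAction4 U₀ ≤ wilsonAction4 U₁ := hmin.2.2 U₁ hU₁ hA
  have hN : (0 : ℝ) ≤ 2 * N := by positivity
  have hlt : 2 * N * wilsonAction4 U₀ < r ^ 2 := (mul_le_mul_of_nonneg_left hAct hN).trans_lt hact
  have hU₀q : ∀ q, dist1 (GaugeField.plaqHol U₀ q) < r := fun q => dist1_plaqHol_lt_of_wilsonAction4_lt hr0 hlt q
  have hmem := mem_classTop_of_forall_dist1_lt hd Ω Sup k hr0 hr hU₀q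
  refine ⟨U₀, ⟨hmem, hmin.2.1, fun V hV hVA => hmin.2.2 V ?_ hVA⟩, hU₀q⟩
  exact mem_class17_of_mem_classTop_of_agreeOn (avOfRecord F N K) hk hU₁ hA hV hVA

end Existence

end Summit.QuantumFields.YangMills.Theorems.K0TopClassSmallActionMinimiser

end
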